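import Literature.NumberTheory.EllipticCurves.UniversalOrdinaryFunctionalEquation
import Mathlib.RingTheory.Filtration
import HarnessLib

/-!
# `R_H → R̂` is injective and the universal ordinary curve is ELLIPTIC over every field through
# which `R̂` embeds (Blakestad–Grant 2023, §2; proofs only)

Trunk T-NT-EC (Literature/NumberTheory/EllipticCurves). Blakestad–Grant (J. Number Theory 249
(2023), §2.1) work with the universal curve `𝓔 : y² = x³ + A₄x + A₆` over `R̂` (the `p`-adic
completion of `R_H = ℤ[A₄,A₆][1/H]`), "elliptic over the open subscheme where `Δ` is invertible",
and with its base change `E` to the fraction field `K` of `R̂` (Prop. 3, §2.3: "let `E, E', G` be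
the basechanges … over `K`, the fraction field of `R̂`"). The Vélu files of the tree
(`VeluOddKernelProofs` &c.) are stated for `[W.IsElliptic]` over a field. This file supplies:

* `isHausdorff_localizedRing` — `⋂ₙ pⁿR_H = 0` (Krull's intersection theorem for the noetherian
  domain `R_H`), hence **`algebraMap_localized_completeRing_injective : R_H ↪ R̂`** and
  `algebraMap_coeffRing_completeRing_injective : ℤ[A₄,A₆] ↪ R̂` (`p ≥ 5`);
* `Δ_curve`, `Δ_curve_ne_zero` — `Δ(y² = x³ + A₄x + A₆) = -(64A₄³ + 432A₆²) ≠ 0` in `ℤ[A₄,A₆]`;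
  **`Δ_universalCurve_ne_zero : Δ(𝓔) ≠ 0` in `R̂`**;
* **`isElliptic_universalCurve_map`** — for any INJECTIVE ring map `g : R̂ → F` into a field,
  `𝓔 ⊗ F` is an elliptic curve (`IsElliptic`); in particular over `Frac R̂` and over every field
  extension of it (the setting of Blakestad–Grant's Prop. 7 / Lemma 11 and of
  `VeluKernelReductionProofs`).

## Sources

* C. Blakestad, D. Grant, J. Number Theory 249 (2023) 348–376 (arXiv:1903.02480), §2.1 (`R`, `R_H`,
  `R̂`, "the model (1) defines an elliptic curve over `R_Δ`"), §2.3. [BlakestadGrant2023]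
* Krull's intersection theorem (Mathlib `Ideal.iInf_pow_eq_bot_of_isDomain`). [folklore]

Pure proof file: no definitions, no named facts.
-/

noncomputable section

namespace Literature.NumberTheory.EllipticCurves.UniversalOrdinary

open Literature.RingTheory.AdicTopology

variable (p : ℕ) [Fact p.Prime]

/-- **`R_H` is `p`-adically separated**: `⋂ₙ pⁿR_H = 0` (Krull; `R_H` is a noetherian domain and
`(p) ≠ R_H`). [folklore] -/
theorem isHausdorff_localizedRing (hp5 : 5 ≤ p) :
    IsHausdorff (Ideal.span {(p : localizedRing p)}) (localizedRing p) := by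
  haveI := isDomain_localizedRing p hp5
  have hne : Ideal.span {(p : localizedRing p)} ≠ ⊤ := (span_natCast_isPrime_localizedRing p hp5).ne_top
  have hKrull := Ideal.iInf_pow_eq_bot_of_isDomain (I := Ideal.span {(p : localizedRing p)}) hne
  rw [isHausdorff_iff]
  intro x hx
  have hmem : x ∈ (⨅ n : ℕ, Ideal.span {(p : localizedRing p)} ^ n) := by
    rw [Ideal.mem_iInf]
    intro n
    have h := hx n
    rw [SModEq.zero, smul_eq_mul, Ideal.mul_top] at h
    exact h
  rw [hKrull] at hmem
  exact hmem

/-- **`R_H → R̂` is injective** (`p ≥ 5`). [Blakestad–Grant 2023, §2.1] [folklore] -/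
theorem algebraMap_localized_completeRing_injective (hp5 : 5 ≤ p) :
    Function.Injective (algebraMap (localizedRing p) (completeRing p)) := by
  haveI := isHausdorff_localizedRing p hp5
  intro x y hxy
  rw [algebraMap_eq_of, algebraMap_eq_of] at hxy
  exact AdicCompletion.of_injective _ _ hxy

/-- **`ℤ[A₄,A₆] → R̂` is injective** (`p ≥ 5`). [folklore] -/
theorem algebraMap_coeffRing_completeRing_injective (hp5 : 5 ≤ p) :
    Function.Injective (algebraMap coeffRing (completeRing p)) := by
  intro x y hxy
  rw [algebraMap_coeffRing_apply, algebraMap_coeffRing_apply] at hxy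
  exact algebraMap_localizedRing_injective p hp5 (algebraMap_localized_completeRing_injective p hp5 hxy)

/-- `Δ(y² = x³ + A₄x + A₆) = -(64A₄³ + 432A₆²)`. [Silverman AEC III.1] [folklore] -/
theorem Δ_curve : curve.Δ = -(64 * A₄ ^ 3 + 432 * A₆ ^ 2) := by
  simp only [WeierstrassCurve.Δ, WeierstrassCurve.b₂, WeierstrassCurve.b₄, WeierstrassCurve.b₆,
    WeierstrassCurve.b₈, curve]
  ring

/-- `Δ(y² = x³ + A₄x + A₆) ≠ 0` in `ℤ[A₄, A₆]` (evaluate at `(A₄, A₆) = (0, 1)`). [folklore] -/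
theorem Δ_curve_ne_zero : curve.Δ ≠ 0 := by
  rw [Δ_curve]
  intro h
  have h1 := congrArg (MvPolynomial.eval ![(0 : ℤ), 1]) h
  simp [A₄, A₆] at h1

/-- **`Δ(𝓔) ≠ 0` in `R̂`** (`p ≥ 5`). [Blakestad–Grant 2023, §2.1] [folklore] -/
theorem Δ_universalCurve_ne_zero (hp5 : 5 ≤ p) : (universalCurve p).Δ ≠ 0 := by
  rw [← curve_map_algebraMap, WeierstrassCurve.map_Δ]
  exact (map_ne_zero_iff _ (algebraMap_coeffRing_completeRing_injective p hp5)).mpr Δ_curve_ne_zero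

/-- **The universal ordinary curve is elliptic over every field into which `R̂` embeds** (e.g. the
fraction field `K` of `R̂` and its extensions: Blakestad–Grant's `E/K`). [Blakestad–Grant 2023,
§2.1, §2.3] [cite: BlakestadGrant2023, §2.3] -/
theorem isElliptic_universalCurve_map (hp5 : 5 ≤ p) {F : Type*} [Field F] (g : completeRing p →+* F)
    (hg : Function.Injective g) : ((universalCurve p).map g).IsElliptic := by
  refine ⟨isUnit_iff_ne_zero.mpr ?_⟩
  rw [WeierstrassCurve.map_Δ]
  exact (map_ne_zero_iff g hg).mpr (Δ_universalCurve_ne_zero p hp5)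

/-- In particular over the fraction field of `R̂`. [cite: BlakestadGrant2023, §2.3] -/
theorem isElliptic_universalCurve_fractionRing (hp5 : 5 ≤ p) :
    letI := isDomain_completeRing p hp5
    ((universalCurve p).map (algebraMap (completeRing p) (FractionRing (completeRing p)))).IsElliptic := by
  letI := isDomain_completeRing p hp5
  exact isElliptic_universalCurve_map p hp5 _ (IsFractionRing.injective (completeRing p) (FractionRing (completeRing p)))

end Literature.NumberTheory.EllipticCurves.UniversalOrdinary
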